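import Summits.ResolutionOfSingularities.ResolutionOfSingularities.Theorems.FrobeniusClosingSteerWords07SteeredLeaves

/-!
# Crux `Steer` (stmt-ResolutionOfSingularities-16345), line `switching-dichotomy` — WORDS 08: §σ2.13 / §σ2.13b of the p = 2 σ_top-STEERED COMPOSITION — K(3) AT FIXED p-RANK (idea-1 g5: `NoEternalIsolatedRadicandChainFinAt`, the `…Fin ↔ ∀ e, …FinAt` bookkeeping, PACKAGE (II) the INTRINSIC finrank currency `NoEternalIsolatedRadicandChainFinrank`, `GeoDictFinrank` and their glue) (HOIST of the registered skeleton r36 91a5a25981868d37, l.830–1054, inside `section SteeredTwo`)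

Holder res-L0-w41-lead-1 g5 on res-L0-w41-plan-1 RULING 47 (E1) / 104b; see `…Words01Core` for the hoist protocol (bodies byte for byte;
`[cite: …]` / `[folklore]` tags on CLOSED `def … : Prop` words are written «(ref. …)» / «(folklore)» — GATE NOTE of `…Words02Stubs`;
cite keys inside `[cite:]` tags normalised to `references.bib` keys where needed, as in `…Words03Phases`).
Nothing here is a statement of the manuscript [claim: Hironaka2017, status: under-review]. OURS (candidates / vocabulary; AI review is
weaker than expert review).
-/

open Summit.ResolutionOfSingularities.ResolutionOfSingularities.Theses.FrobeniusClosing (IsolatedForcedTermination)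
open Literature.AlgebraicGeometry.Resolution (IsAbhyankarPlace FGOver exists_ringKrullDim_eq_and_trdeg_eq
  trdeg_eq_trdeg_of_isFractionRing locAtCentre IsQuadraticTransformAlong SubringDominates IsRsopPart
  LocalUniformization3 RelLocalUniformization CossartPiltant2019General)
open Summit.ResolutionOfSingularities.ResolutionOfSingularities.Theorems.SteerRankThinness
  (HasProperCoarsening concl_of_hasProperCoarsening rankOne_of_not_hasProperCoarsening)
open Summit.ResolutionOfSingularities.ResolutionOfSingularities.Theorems.PfaffLine

set_option linter.dupNamespace false

namespace Summit.ResolutionOfSingularities.ResolutionOfSingularities.Theorems.SwitchingDichotomy.Words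

section SteeredTwo

open IsLocalRing
open Literature.AlgebraicGeometry.Resolution (IsLocalBlowupAlong IsQuadraticTransform IsExcellentRing)

variable {K : Type} [Field K]


/-! ### §σ2.13 (idea-1 g5, ADDENDUM to snippet v9 d77e7518e1f8f795 §σ2.11; paste before `end SteeredTwo`) — K(3) AT FIXED p-RANK.
THE CATCH in §σ2.11: `NoEternalIsolatedRadicandChainFin p 3` hides `∀ e` (`…Fin p c ↔ ∀ e, …FinAt p c e`, proved below): it asks
the K-side for codimension-3 isolated radicand chains over residue fields of EVERY finite p-rank `e` — for `e ≥ 2` that is the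
codim-3 stratum of `t^p = f` on regular schemes of dimension `3 + e ≥ 5`, which the `n = 4` summit never meets (G's members at
`n = 4`, `c = 3` have residue p-rank `e = n - c = 1`, stub-10 p500784) and which the finite-state closing (idea-1 technique A) can
only serve one `(p, c, e)` at a time.  THE FIX (additive; nothing adopted changes; adoption by `exact`):
* K · `NoEternalIsolatedRadicandChainFinAt p c e` = §σ2.11 VERBATIM with the family size `e` OUTSIDE the existential;
  K(3) OF RECORD (n = 4) := `∀ p, p.Prime → NoEternalIsolatedRadicandChainFinAt p 3 1`; K(1) e-free and K(2)ᶠⁱⁿ unchanged.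
* P⁺ · `FGFieldPBasisDualAt` = P with the family size PINNED to `d` by `[F : F^p] = p^d` (the p-basis constructed for P has
  `#B = trdeg` and `[F : F^p] = p^#B` — tree `Literature.FieldTheory.Separability.finrank_frobenius_eq_pow_card` p497687 — so this
  is P's proof plus `Nat.pow_right_injective`); idea-1 Sketch v6 §7c `FinrankDerivationAdapter` is the same statement WITHOUT the
  FG hypothesis (plan over `Literature/…/PIndependence` + `PIndependentDerivations`).
* G⁺⁺ · `GeoDictFinAt` = `GeoDictFin` VERBATIM with conclusion `¬ NoEternalIsolatedRadicandChainFinAt p c (n - c)`; its ONE new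
  duty is the size pin: `d := n - c = dim (A ⧸ 𝔭)` and p500784 `finrank_frobenius_residueField_eq_pow … (hd : ringKrullDim (A ⧸ P) = d)`
  gives `[κ : κ^p] = p^(n-c)` BY NAME, then P⁺ at `d = n - c`.  `GeoDictFinAt → GeoDictFin` (proved), so nothing downstream of G⁺ breaks.
* T · `eternalSteeredRunTwo_of_finAt2 : SteeredTailConclTwo → GeoDictFinAt → K(2)ᶠⁱⁿ → K(3)-at-1 → EternalSteeredRunTwo` (proved;
  c-dispatch at `e = 4 - c`).  OURS. -/

/-- **K(c)ᶠⁱⁿ AT p-RANK `e`** (idea-1 v6 §7c): §σ2.11 VERBATIM, family size `e` an OUTER parameter. OURS. [folklore] -/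
def NoEternalIsolatedRadicandChainFinAt (p c e : ℕ) : Prop :=
  ∀ (L : Type) [Field L] [CharP L p] (S : ℕ → Subring L) [∀ m, IsLocalRing (S m)],
    (∃ D : Fin e → Derivation ℤ (ResidueField (S 0)) (ResidueField (S 0)),
        ∀ z : ResidueField (S 0), (∀ l, D l z = 0) ↔ ∃ y : ResidueField (S 0), y ^ p = z) →
    ∀ (hle : ∀ m, S m ≤ S (m + 1)) (f g : ∀ m, S m) (x : ∀ m, S (m + 1)),
    (∀ m, IsRegularLocalRing (S m)) → (∀ m, IsExcellentRing (S m)) → (∀ m, ringKrullDim (S m) = c) →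
    (∀ m, IsQuadraticTransform (S m) (S (m + 1))) →
    (∀ m, Ideal.span ((fun y : S m => (⟨(y : L), hle m y.2⟩ : S (m + 1))) '' (maximalIdeal (S m) : Set (S m)))
        = Ideal.span {x m}) →
    (∀ m, ((f (m + 1) : S (m + 1)) : L) * ((x m : S (m + 1)) : L) ^ p = ((f m : S m) : L) - ((g m : S m) : L) ^ p) →
    (∀ m, ∃ h : S m, f m - h ^ p ∈ maximalIdeal (S m) ^ p) →
    (∀ m, HasIsolatedSingularity (RadicandRing (S m) p (f m))) →
    False

/-- `K(c)ᶠⁱⁿ ↔ ∀ e, K(c)-at-e` (PROVED): the adopted K(3)ᶠⁱⁿ is the conjunction over ALL p-ranks. [folklore] -/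
theorem noEternalIsolatedRadicandChainFin_iff_finAt (p c : ℕ) :
    NoEternalIsolatedRadicandChainFin p c ↔ ∀ e, NoEternalIsolatedRadicandChainFinAt p c e :=
  ⟨fun h e L _ _ S _ hD => h L S (hD.elim fun D hD => ⟨e, D, hD⟩),
   fun h L _ _ S _ hD => hD.elim fun e hD => h e L S hD⟩

/-- The e-free K(c) feeds every p-rank (PROVED). [folklore] -/
theorem noEternalIsolatedRadicandChainFinAt_of_chain (p c e : ℕ) (h : NoEternalIsolatedRadicandChain p c) :
    NoEternalIsolatedRadicandChainFinAt p c e :=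
  fun L _ _ S _ _ => h L S

/-- K(c)-at-e is ANTITONE in the family size (PROVED; pad with zero derivations) — so the size is NOT the p-rank unless pinned
from outside, which is why G⁺⁺ pins it through P⁺. [folklore] -/
theorem noEternalIsolatedRadicandChainFinAt_anti (p c : ℕ) {e e' : ℕ} (hee : e ≤ e')
    (h : NoEternalIsolatedRadicandChainFinAt p c e') : NoEternalIsolatedRadicandChainFinAt p c e := by
  intro L _ _ S _ hD
  obtain ⟨D, hD⟩ := hD
  refine h L S ⟨fun l => if hl : (l : ℕ) < e then D ⟨l, hl⟩ else 0, fun z => ?_⟩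
  rw [← hD z]
  constructor
  · intro hz l
    have := hz (Fin.castLE hee l)
    simpa [Fin.castLE, l.2] using this
  · intro hz l
    by_cases hl : (l : ℕ) < e
    · simp [hl, hz ⟨l, hl⟩]
    · simp [hl]

/-- **P⁺ · FGFieldPBasisDualAt** (DISCHARGEABLE, S/M — P's proof + `finrank_frobenius_eq_pow_card` + `Nat.pow_right_injective`;
`Fact p.Prime` is an EXPLICIT binder, apply with `⟨hp⟩`; `[CharP F p]` from `charP_of_injective_algebraMap`): the dual family of a
p-basis, OF THE SIZE `d` READ OFF `[F : F^p] = p^d`. OURS. (folklore) -/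
def FGFieldPBasisDualAt : Prop :=
  ∀ (p : ℕ) (_ : Fact p.Prime) (k F : Type) [Field k] [CharP k p] [PerfectField k] [Field F] [CharP F p] [Algebra k F],
    (⊤ : IntermediateField k F).FG → ∀ d : ℕ, Module.finrank (frobenius F p).fieldRange F = p ^ d →
    ∃ D : Fin d → Derivation ℤ F F, ∀ z : F, (∀ l, D l z = 0) ↔ ∃ y : F, y ^ p = z

/-- **G⁺⁺ · GeoDictFinAt** (DISCHARGEABLE: `GeoDictFin`'s construction + the size pin `e = n - c` via p500784 and P⁺): a dominant
tail of height `c` in dimension `n` yields an eternal isolated radicand chain in codimension `c` whose first residue field carries a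
kernel-exact derivation family OF SIZE `n - c`. OURS. (folklore) -/
def GeoDictFinAt : Prop :=
  ∀ p : ℕ, p.Prime → ∀ n : ℕ, 4 ≤ n →
    ∀ (k K : Type) [Field k] [CharP k p] [PerfectField k] [Field K] [Algebra k K]
    (O : ValuationSubring K) (A₀ : Subalgebra k K) (h₀ : A₀.toSubring ≤ O.toSubring) (t : K),
    CoreDatum p n k K O A₀ h₀ t →
    ∀ (R : ℕ → Subring K) (P : (i : ℕ) → Ideal (R i)) (s : ℕ → K) (i₀ c : ℕ),
      R 0 = locAtCentre A₀.toSubring O → IsSteeredRun O R P t p s → IsDominantTail R P i₀ c →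
      ¬ NoEternalIsolatedRadicandChainFinAt p c (n - c)

/-- G⁺⁺ refines G⁺ (PROVED) — nothing downstream of `GeoDictFin` breaks. [folklore] -/
theorem geoDictFin_of_finAt (hG : GeoDictFinAt) : GeoDictFin :=
  fun p hp n hn k K _ _ _ _ _ O A₀ h₀ t core R P s i₀ c hR0 hrun ht hK =>
    hG p hp n hn k K O A₀ h₀ t core R P s i₀ c hR0 hrun ht ((noEternalIsolatedRadicandChainFin_iff_finAt p c).mp hK (n - c))

/-- **T from its line, K(3) AT p-RANK 1** (PROVED; the c-dispatch at `e = 4 - c`): σ-residual + G⁺⁺ + S + K(2)ᶠⁱⁿ + K(3)-at-1;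
K(1) discharged (p500126). Pure logic. OURS. [folklore] -/
theorem eternalSteeredRunTwo_of_finAt (hTail : SteeredTailConclTwo) (hG : GeoDictFinAt) (hcb : TailCodimBound)
    (hK2 : ∀ p : ℕ, p.Prime → NoEternalIsolatedRadicandChainFin p 2)
    (hK3 : ∀ p : ℕ, p.Prime → NoEternalIsolatedRadicandChainFinAt p 3 1) : EternalSteeredRunTwo := by
  intro p hp2 k K _i1 _i2 _i3 _i4 _i5 O A₀ h₀ t core hrank R P s hR0 hrun
  have hp : p.Prime := hp2 ▸ Nat.prime_two
  by_cases htail : ∃ i₀ c : ℕ, 1 ≤ c ∧ IsDominantTail R P i₀ c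
  · obtain ⟨i₀, c, hc1, ht⟩ := htail
    have hnc : ¬ NoEternalIsolatedRadicandChainFinAt p c (4 - c) :=
      hG p hp 4 le_rfl k K O A₀ h₀ t core R P s i₀ c hR0 hrun ht
    have hc4 : c + 1 ≤ 4 := hcb p hp 4 le_rfl k K O A₀ h₀ t core R P s i₀ c hR0 hrun ht
    have hc3 : c ≤ 3 := by omega
    interval_cases c
    · exact (hnc (noEternalIsolatedRadicandChainFinAt_of_chain p 1 3 (noEternalIsolatedRadicandChain_one_holds p hp))).elim
    · exact (hnc ((noEternalIsolatedRadicandChainFin_iff_finAt p 2).mp (hK2 p hp) 2)).elim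
    · exact (hnc (hK3 p hp)).elim
  · exact hTail p hp2 k K O A₀ h₀ t core hrank R P s hR0 hrun htail

/-- … with S discharged (p502821). [folklore] -/
theorem eternalSteeredRunTwo_of_finAt2 (hTail : SteeredTailConclTwo) (hG : GeoDictFinAt)
    (hK2 : ∀ p : ℕ, p.Prime → NoEternalIsolatedRadicandChainFin p 2)
    (hK3 : ∀ p : ℕ, p.Prime → NoEternalIsolatedRadicandChainFinAt p 3 1) : EternalSteeredRunTwo :=
  eternalSteeredRunTwo_of_finAt hTail hG tailCodimBound_holds hK2 hK3

/-! #### §σ2.13b — PACKAGE (II), the INTRINSIC currency (idea-1's RECOMMENDATION for G's sequel: no derivation family on the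
G side at all).  `NoEternalIsolatedRadicandChainFinrank p c e` = the e-free chain binders + `Fact p.Prime` (explicit, apply with
`⟨hp⟩`) + `[∀ m, CharP (ResidueField (S m)) p]` (discharged by `charP_residueField_subring`) + ONE hypothesis
`∀ m, finrank (frobenius κ_m p).fieldRange κ_m = p ^ e` — EXACTLY what stub-10's p500784 `finrank_frobenius_residueField_eq_pow`
outputs (after transport along `κ(P_m) ≃+* ResidueField (S m)`, finrank being invariant).  G⁺ := `GeoDictFinrank` closes from the
landed G p503815 + p500784 + that transport; the p-basis work moves to the K-side as the support `FinrankDerivationAdapter`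
(stub-3's P draft fc604e10ed3bdf27 is most of it: `exists_derivation_commonKernel` + the size pin `#S = e` from `[F : F^p] = p^e`);
K(3) OF RECORD (n = 4) := `∀ p, p.Prime → NoEternalIsolatedRadicandChainFinrank p 3 1`; T-line `eternalSteeredRunTwo_of_finrank2`
(K(2) e-free, as `_of_fin'` already expects from the res-type-026 port). -/

/-- **K(c) AT RESIDUE p-RANK `e`, intrinsic form** (idea-1 v6 §7c). OURS. [folklore] -/
def NoEternalIsolatedRadicandChainFinrank (p c e : ℕ) : Prop :=
  ∀ (_ : Fact p.Prime) (L : Type) [Field L] [CharP L p] (S : ℕ → Subring L) [∀ m, IsLocalRing (S m)]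
    [∀ m, CharP (ResidueField (S m)) p]
    (hle : ∀ m, S m ≤ S (m + 1)) (f g : ∀ m, S m) (x : ∀ m, S (m + 1)),
    (∀ m, IsRegularLocalRing (S m)) → (∀ m, IsExcellentRing (S m)) → (∀ m, ringKrullDim (S m) = c) →
    (∀ m, Module.finrank (frobenius (ResidueField (S m)) p).fieldRange (ResidueField (S m)) = p ^ e) →
    (∀ m, IsQuadraticTransform (S m) (S (m + 1))) →
    (∀ m, Ideal.span ((fun y : S m => (⟨(y : L), hle m y.2⟩ : S (m + 1))) '' (maximalIdeal (S m) : Set (S m)))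
        = Ideal.span {x m}) →
    (∀ m, ((f (m + 1) : S (m + 1)) : L) * ((x m : S (m + 1)) : L) ^ p = ((f m : S m) : L) - ((g m : S m) : L) ^ p) →
    (∀ m, ∃ h : S m, f m - h ^ p ∈ maximalIdeal (S m) ^ p) →
    (∀ m, HasIsolatedSingularity (RadicandRing (S m) p (f m))) →
    False

/-- The e-free K(c) feeds every residue p-rank (PROVED). [folklore] -/
theorem noEternalIsolatedRadicandChainFinrank_of (p c : ℕ) (h : NoEternalIsolatedRadicandChain p c) (e : ℕ) :
    NoEternalIsolatedRadicandChainFinrank p c e :=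
  fun _ L _ _ S _ _ hle f g x hreg hexc hdim _ => h L S hle f g x hreg hexc hdim

/-- G's instance obligation (PROVED): residue fields of local subrings of a char-`p` field have char `p`. [folklore] -/
theorem charP_residueField_subring (p : ℕ) [Fact p.Prime] (L : Type) [Field L] [CharP L p] (S : Subring L)
    [IsLocalRing S] : CharP (ResidueField S) p := by
  have h0 : ((p : ℕ) : ResidueField S) = 0 := by
    have : ((p : ℕ) : S) = 0 := by exact_mod_cast (CharP.cast_eq_zero S p)
    rw [← map_natCast (IsLocalRing.residue S) p, this, map_zero]
  exact (CharP.charP_iff_prime_eq_zero Fact.out).mpr h0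

/-- **K-side support · FinrankDerivationAdapter** (DISCHARGEABLE, S/M; = P re-targeted: NO finite-generation hypothesis, the size
pinned by `[κ : κ^p] = p^e`; plan: `Literature.AlgebraicGeometry.Resolution.exists_isPIndependent_adjoin_eq_top` + `IsPIndependent.finrank_eq`
(a p-basis `B`, `p^#B = p^e`), duals by `Literature.FieldTheory.Separability.exists_derivation_eq_one_eqOn_zero` on `κ^p(B ∖ b)`,
kernel by expansion in p-monomials / stub-3's `mem_frobenius_of_forall_dual_eq_zero`). OURS. [cite: Matsumura1987, §26 p. 202] -/
def FinrankDerivationAdapter (p : ℕ) : Prop :=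
  ∀ (_ : Fact p.Prime) (κ : Type) [Field κ] [CharP κ p] (e : ℕ),
    Module.finrank (frobenius κ p).fieldRange κ = p ^ e →
    ∃ D : Fin e → Derivation ℤ κ κ, ∀ z : κ, (∀ l, D l z = 0) ↔ ∃ y : κ, y ^ p = z

/-- AT-e form ⇒ finrank form, modulo the adapter at level `0` (PROVED). [folklore] -/
theorem noEternalIsolatedRadicandChainFinrank_of_finAt (p c e : ℕ) (hA : FinrankDerivationAdapter p)
    (h : NoEternalIsolatedRadicandChainFinAt p c e) : NoEternalIsolatedRadicandChainFinrank p c e := by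
  intro hp L _ _ S _ _ hle f g x hreg hexc hdim hprank
  exact h L S (hA hp (ResidueField (S 0)) e (hprank 0)) hle f g x hreg hexc hdim

/-- **G⁺ · GeoDictFinrank** (DISCHARGEABLE from the LANDED G p503815 + p500784 + `charP_residueField_subring` + transport of
`finrank` along `κ(P_m) ≃+* ResidueField (S m)`; no derivations): the chain of a dominant tail of height `c` in dimension `n` has
residue p-rank `n - c` at every member. OURS. (folklore) -/
def GeoDictFinrank : Prop :=
  ∀ p : ℕ, p.Prime → ∀ n : ℕ, 4 ≤ n →
    ∀ (k K : Type) [Field k] [CharP k p] [PerfectField k] [Field K] [Algebra k K]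
    (O : ValuationSubring K) (A₀ : Subalgebra k K) (h₀ : A₀.toSubring ≤ O.toSubring) (t : K),
    CoreDatum p n k K O A₀ h₀ t →
    ∀ (R : ℕ → Subring K) (P : (i : ℕ) → Ideal (R i)) (s : ℕ → K) (i₀ c : ℕ),
      R 0 = locAtCentre A₀.toSubring O → IsSteeredRun O R P t p s → IsDominantTail R P i₀ c →
      ¬ NoEternalIsolatedRadicandChainFinrank p c (n - c)

/-- G⁺ (finrank) refines G (PROVED). [folklore] -/
theorem geoDict_of_finrank (hG : GeoDictFinrank) : GeoDict :=
  fun p hp n hn k K _ _ _ _ _ O A₀ h₀ t core R P s i₀ c hR0 hrun ht hK =>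
    hG p hp n hn k K O A₀ h₀ t core R P s i₀ c hR0 hrun ht (noEternalIsolatedRadicandChainFinrank_of p c hK (n - c))

/-- **T from its line, PACKAGE (II)** (PROVED): σ-residual + G⁺(finrank) + S + K(2) e-free + K(3) at residue p-rank 1. [folklore] -/
theorem eternalSteeredRunTwo_of_finrank (hTail : SteeredTailConclTwo) (hG : GeoDictFinrank) (hcb : TailCodimBound)
    (hK2 : ∀ p : ℕ, p.Prime → NoEternalIsolatedRadicandChain p 2)
    (hK3 : ∀ p : ℕ, p.Prime → NoEternalIsolatedRadicandChainFinrank p 3 1) : EternalSteeredRunTwo := by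
  intro p hp2 k K _i1 _i2 _i3 _i4 _i5 O A₀ h₀ t core hrank R P s hR0 hrun
  have hp : p.Prime := hp2 ▸ Nat.prime_two
  by_cases htail : ∃ i₀ c : ℕ, 1 ≤ c ∧ IsDominantTail R P i₀ c
  · obtain ⟨i₀, c, hc1, ht⟩ := htail
    have hnc : ¬ NoEternalIsolatedRadicandChainFinrank p c (4 - c) :=
      hG p hp 4 le_rfl k K O A₀ h₀ t core R P s i₀ c hR0 hrun ht
    have hc4 : c + 1 ≤ 4 := hcb p hp 4 le_rfl k K O A₀ h₀ t core R P s i₀ c hR0 hrun ht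
    have hc3 : c ≤ 3 := by omega
    interval_cases c
    · exact (hnc (noEternalIsolatedRadicandChainFinrank_of p 1 (noEternalIsolatedRadicandChain_one_holds p hp) 3)).elim
    · exact (hnc (noEternalIsolatedRadicandChainFinrank_of p 2 (hK2 p hp) 2)).elim
    · exact (hnc (hK3 p hp)).elim
  · exact hTail p hp2 k K O A₀ h₀ t core hrank R P s hR0 hrun htail

/-- … with S discharged (p502821). [folklore] -/
theorem eternalSteeredRunTwo_of_finrank2 (hTail : SteeredTailConclTwo) (hG : GeoDictFinrank)
    (hK2 : ∀ p : ℕ, p.Prime → NoEternalIsolatedRadicandChain p 2)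
    (hK3 : ∀ p : ℕ, p.Prime → NoEternalIsolatedRadicandChainFinrank p 3 1) : EternalSteeredRunTwo :=
  eternalSteeredRunTwo_of_finrank hTail hG tailCodimBound_holds hK2 hK3

/-- … and with K(2) in the adopted ᶠⁱⁿ form, through the adapter (PROVED). [folklore] -/
theorem eternalSteeredRunTwo_of_finrank3 (hTail : SteeredTailConclTwo) (hG : GeoDictFinrank)
    (hA : ∀ p : ℕ, FinrankDerivationAdapter p)
    (hK2 : ∀ p : ℕ, p.Prime → NoEternalIsolatedRadicandChainFin p 2)
    (hK3 : ∀ p : ℕ, p.Prime → NoEternalIsolatedRadicandChainFinrank p 3 1) : EternalSteeredRunTwo := by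
  intro p hp2 k K _i1 _i2 _i3 _i4 _i5 O A₀ h₀ t core hrank R P s hR0 hrun
  have hp : p.Prime := hp2 ▸ Nat.prime_two
  by_cases htail : ∃ i₀ c : ℕ, 1 ≤ c ∧ IsDominantTail R P i₀ c
  · obtain ⟨i₀, c, hc1, ht⟩ := htail
    have hnc : ¬ NoEternalIsolatedRadicandChainFinrank p c (4 - c) :=
      hG p hp 4 le_rfl k K O A₀ h₀ t core R P s i₀ c hR0 hrun ht
    have hc4 : c + 1 ≤ 4 := tailCodimBound_holds p hp 4 le_rfl k K O A₀ h₀ t core R P s i₀ c hR0 hrun ht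
    have hc3 : c ≤ 3 := by omega
    interval_cases c
    · exact (hnc (noEternalIsolatedRadicandChainFinrank_of p 1 (noEternalIsolatedRadicandChain_one_holds p hp) 3)).elim
    · exact (hnc (noEternalIsolatedRadicandChainFinrank_of_finAt p 2 2 (hA p)
        ((noEternalIsolatedRadicandChainFin_iff_finAt p 2).mp (hK2 p hp) 2))).elim
    · exact (hnc (hK3 p hp)).elim
  · exact hTail p hp2 k K O A₀ h₀ t core hrank R P s hR0 hrun htail


end SteeredTwo

end Summit.ResolutionOfSingularities.ResolutionOfSingularities.Theorems.SwitchingDichotomy.Words
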